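import Mathlib.RingTheory.MvPolynomial.WeightedHomogeneous
import Mathlib.RingTheory.MvPolynomial.Basic
import Mathlib.RingTheory.Ideal.Operations
import Mathlib.Algebra.BigOperators.Fin
import HarnessLib

/-!
# Veronese splitting for the weights `(14,6,21)` and `N = 84` — the BP(2,3,7) calibration
(crux `FInjectiveMacaulayfication`, line `Sketch`, §15 weighted cone engine)

Support file for crux stmt-ResolutionOfSingularities-15315 (`FrobeniusLadder.FInjectiveMacaulayfication`,
line `Sketch`). [OURS · L1 W4.5a, BP-TAME CALIBRATION of CRUX-PLAN §6] — the Veronese-saturation hypothesis of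
the weighted cone engine (#23 `stub_weightedConeFiModel`) for the Brieskorn–Pham specimen `f = z² + x³ + y⁷`
(variables `X₀ = x, X₁ = y, X₂ = z`, weights `w = (14, 6, 21)`, `f` weighted homogeneous of degree `42`).

Let `I₈₄ ⊆ k[X₀,X₁,X₂]` be the ideal spanned by the monomials `X^b` of weighted degree
`14b₀ + 6b₁ + 21b₂ ≥ 84`. **Veronese splitting**: every monomial of weighted degree `≥ 84K` lies in `I₈₄^K`.
(For `N = 42` the analogous statement is FALSE: `x²y⁶z` has weight `85 ≥ 84` but is not a product of two
monomials of weight `≥ 42` — which is why the calibration uses `N = 84`, `c = (6,14,4)`, `D = 42`.)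

Proof. Induction on `K` through the exponent-vector statement `coord_split`: if `(K+1)·84 ≤ w·a` then
`a = b + c` with `84 ≤ w·b` and `K·84 ≤ w·c`. PEEL a pure block `x⁶`, `y¹⁴`, `z⁴` (weight exactly `84`) when an
exponent is large; otherwise `a` lies in the box `a₀ ≤ 5, a₁ ≤ 13, a₂ ≤ 3` of weight `≤ 211 < 252`, so
`K ≤ 1`; `K = 0` is trivial and for `K = 1` (weight `≥ 168`) one of the three mixed blocks of weight exactly
`84` — `y⁷z²`, `x³y⁷`, `x³z²` — divides `X^a` (a linear-arithmetic fact, `omega`). All glue on Mathlib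
(`Finsupp.weight_apply`, `Fin.sum_univ_three`, `MvPolynomial.monomial_mul`, `Ideal.mul_mem_mul`); template:
`VeroneseSplitting` (p173737, weights `(6,3,9,2)`). [folklore]
-/

-- single-problem summit: the doubled namespace component is forced
set_option linter.dupNamespace false

namespace Summit.ResolutionOfSingularities.ResolutionOfSingularities.Theorems.FInjectiveMacaulayfication.BP237VeroneseSplitting

/-- **Coordinate splitting** for `w = (14,6,21)`, `N = 84`: if `(K+1)·84 ≤ 14a₀ + 6a₁ + 21a₂` then
`(a₀,a₁,a₂) = b + c` with `84 ≤ w·b` and `K·84 ≤ w·c` — peel `x⁶`, `y¹⁴` or `z⁴`; in the remaining box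
(`a₀ ≤ 5, a₁ ≤ 13, a₂ ≤ 3`, weight `≤ 211`) `K ≤ 1`, and for `K = 1` one of `y⁷z²`, `x³y⁷`, `x³z²` (weight
exactly `84`) divides. [folklore] -/
theorem coord_split (K a₀ a₁ a₂ : ℕ) (h : (K + 1) * 84 ≤ 14 * a₀ + 6 * a₁ + 21 * a₂) :
    ∃ b₀ b₁ b₂ c₀ c₁ c₂ : ℕ, a₀ = b₀ + c₀ ∧ a₁ = b₁ + c₁ ∧ a₂ = b₂ + c₂ ∧
      84 ≤ 14 * b₀ + 6 * b₁ + 21 * b₂ ∧ K * 84 ≤ 14 * c₀ + 6 * c₁ + 21 * c₂ := by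
  by_cases h₀ : 6 ≤ a₀
  · exact ⟨6, 0, 0, a₀ - 6, a₁, a₂, by omega⟩
  by_cases h₁ : 14 ≤ a₁
  · exact ⟨0, 14, 0, a₀, a₁ - 14, a₂, by omega⟩
  by_cases h₂ : 4 ≤ a₂
  · exact ⟨0, 0, 4, a₀, a₁, a₂ - 4, by omega⟩
  -- the box `a₀ ≤ 5, a₁ ≤ 13, a₂ ≤ 3`: weight `≤ 211`, hence `K ≤ 1`
  rcases Nat.eq_zero_or_pos K with rfl | hK
  · exact ⟨a₀, a₁, a₂, 0, 0, 0, by omega⟩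
  -- `K = 1`, weight `≥ 168`: a mixed block of weight exactly `84` divides
  by_cases hA : 7 ≤ a₁ ∧ 2 ≤ a₂
  · exact ⟨0, 7, 2, a₀, a₁ - 7, a₂ - 2, by omega⟩
  by_cases hB : 3 ≤ a₀ ∧ 7 ≤ a₁
  · exact ⟨3, 7, 0, a₀ - 3, a₁ - 7, a₂, by omega⟩
  by_cases hC : 3 ≤ a₀ ∧ 2 ≤ a₂
  · exact ⟨3, 0, 2, a₀ - 3, a₁, a₂ - 2, by omega⟩
  exfalso
  omega

/-- The `(14,6,21)`-weighted degree of `f : Fin 3 →₀ ℕ` in coordinates: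
`Finsupp.weight ![14,6,21] f = 14 f₀ + 6 f₁ + 21 f₂`. [folklore] -/
theorem weight_eq (f : Fin 3 →₀ ℕ) :
    Finsupp.weight (![14, 6, 21] : Fin 3 → ℕ) f = 14 * f 0 + 6 * f 1 + 21 * f 2 := by
  rw [Finsupp.weight_apply,
    Finsupp.sum_fintype f (fun i c => c • (![14, 6, 21] : Fin 3 → ℕ) i) (fun _ => zero_smul ℕ _),
    Fin.sum_univ_three]
  simp only [smul_eq_mul, Matrix.cons_val_zero, Matrix.cons_val_one, Matrix.cons_val]
  ring

/-- **Exponent-vector splitting**: if `(K+1)·84 ≤ weight ![14,6,21] a` then `a = b + c` with `84 ≤ weight b`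
and `K·84 ≤ weight c` (`coord_split` along `Finsupp.equivFunOnFinite`). [folklore] -/
theorem finsupp_split (K : ℕ) (a : Fin 3 →₀ ℕ)
    (ha : (K + 1) * 84 ≤ Finsupp.weight (![14, 6, 21] : Fin 3 → ℕ) a) :
    ∃ b c : Fin 3 →₀ ℕ, a = b + c ∧ 84 ≤ Finsupp.weight (![14, 6, 21] : Fin 3 → ℕ) b ∧
      K * 84 ≤ Finsupp.weight (![14, 6, 21] : Fin 3 → ℕ) c := by
  rw [weight_eq] at ha
  obtain ⟨b₀, b₁, b₂, c₀, c₁, c₂, e₀, e₁, e₂, hb, hc⟩ := coord_split K (a 0) (a 1) (a 2) ha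
  refine ⟨Finsupp.equivFunOnFinite.symm ![b₀, b₁, b₂], Finsupp.equivFunOnFinite.symm ![c₀, c₁, c₂],
    ?_, ?_, ?_⟩
  · ext i
    fin_cases i <;> simp [e₀, e₁, e₂]
  · rw [weight_eq]
    simpa using hb
  · rw [weight_eq]
    simpa using hc

/-- **VERONESE SPLITTING for `w = (14,6,21)`, `N = 84`** (the saturation hypothesis of the weighted cone
engine #23 at the BP(2,3,7) data): every monomial of weighted degree `≥ 84K` lies in `I₈₄^K`, `I₈₄` the ideal
spanned by the monomials of weighted degree `≥ 84`. Induction on `K` via `finsupp_split`,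
`MvPolynomial.monomial_mul`, `Ideal.mul_mem_mul`. (False for `N = 42`: `x²y⁶z`.) [folklore] -/
theorem bp237VeroneseSplitting : ∀ (k : Type) [Field k] (K : ℕ) (b : Fin 3 →₀ ℕ),
    K * 84 ≤ Finsupp.weight (![14, 6, 21] : Fin 3 → ℕ) b →
    (MvPolynomial.monomial b (1 : k) : MvPolynomial (Fin 3) k) ∈
      (Ideal.span {m : MvPolynomial (Fin 3) k | ∃ b : Fin 3 →₀ ℕ,
        84 ≤ Finsupp.weight (![14, 6, 21] : Fin 3 → ℕ) b ∧ m = MvPolynomial.monomial b 1}) ^ K := by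
  intro k _ K
  induction K with
  | zero =>
    intro a _
    rw [pow_zero, Ideal.one_eq_top]
    exact Submodule.mem_top
  | succ K ih =>
    intro a ha
    obtain ⟨b, c, rfl, hb, hc⟩ := finsupp_split K a ha
    have hmul : (MvPolynomial.monomial (b + c) (1 : k) : MvPolynomial (Fin 3) k) =
        MvPolynomial.monomial b 1 * MvPolynomial.monomial c 1 := by
      rw [MvPolynomial.monomial_mul, one_mul]
    rw [pow_succ', hmul]
    exact Ideal.mul_mem_mul (Ideal.subset_span ⟨b, hb, rfl⟩) (ih c hc)

end Summit.ResolutionOfSingularities.ResolutionOfSingularities.Theorems.FInjectiveMacaulayfication.BP237VeroneseSplitting
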